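import Summits.AnomalousDissipation.AnomalousDissipation.Theorems.SolenoidalFractalHomogenisationLagrangianStepCellChainSlot
import Summits.AnomalousDissipation.AnomalousDissipation.Theorems.SolenoidalFractalHomogenisationRealisedQuasiStaticCellLawSlotTimes
import HarnessLib

/-!
# K1L_D `LagrangianRenormalisationStepDesign` (stmt-AnomalousDissipation-27980), W7 engine sub-piece S1a: the gauged three-mode chain on the
# ABSOLUTE-TIME WINDOW of slot `s` in period `p`, link `= c_s · A_s(t)` with `A_s` the slot's trapezoid envelope
# (helper; `--supports stmt-AnomalousDissipation-27980`)

Summits-side helper file of route `SolenoidalFractalHomogenisation` (prover seat `ad-k1l-cellLawV-w1` g4; shape request (ii) of the W7 assembly owner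
ad-sawtooth-k1loc-p1 g11, STATUS 2026-08-28T22:16:05Z: «per slot s the gauged modes with `HasDerivAt w₀ (dW0C (c_s·A_s t) K₀ (w₊ t) (w₋ t) (modalAdjGen 𝔹 K₀
(w₀ t))) t` etc., `A_s` = the envelope of the slot, `c_s` constant»).  Everything proved; no definitions, no named facts, no sorry.

* `slot_window` — on the absolute window `t ∈ [pP + start s, pP + start s + τ_s)` of period `p : ℤ`: the replayed phase is `fract(t/P)·P = t − pP`,
  it lies in slot `s`, and the slot's envelope read there is `trapezoid (pP + start s) τ_s ramp t` =: `A_s^p(t)` (K2R `fract_period_mul`, `trapezoid_shift`);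
* **`ae_hasDerivAt_window_dW0C / _dWpC / _dWmC`** — for a.e. `t ∈ (0,T)`, for every period `p`, if `t` is in that window then the gauged representatives
  `w̃ⱼ(t) = μ^j • modeRep … (K₀ + j·K_s) t` (`μ = σ·conj e^{iφ_s}`, `σ = ±1`) satisfy p4 g13's chain shapes with the link
  `l(t) = c_s · A_s^p(t)`, `c_s = σ·(ê_s·K₀)·(1/n)/(2|m_s|)` CONSTANT (take `σ = sgn(ê_s·K₀)`, `sgn_choice`, for `c_s = |ê_s·K₀|(1/n)/(2|m_s|) ≥ 0`)
  and `ỹⱼ = modalAdjGen (majorTranspose 𝔹) Kⱼ w̃ⱼ`.  For the cubature design `ramp = 1/2`, so `A_s^p` is the unit triangle of the window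
  (`∫A² = τ/3`, `|Ȧ| = 2/τ`: `LatticeShear.integral_trapezoid_sq`, p5's `…W7Engine*`).
NOT a proof of any registered stub, of the crux, or of anomalous dissipation; rung F-D1.A0 infrastructure.
-/

set_option linter.dupNamespace false

noncomputable section

namespace Summit.AnomalousDissipation.AnomalousDissipation.Theorems.SolenoidalFractalHomogenisation.LagrangianStep.CellChain

open Set MeasureTheory Filter Topology Function Complex UnitAddTorus
open scoped InnerProductSpace ComplexConjugate
open Literature.Analysis Literature.Analysis.FunctionSpaces Literature.Analysis.FunctionSpaces.Torus
open Literature.Analysis.FluidPDE Literature.Analysis.FluidPDE.Torus Literature.Analysis.FluidPDE.LatticeShear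
open Summit.AnomalousDissipation.AnomalousDissipation.Theorems.SolenoidalFractalHomogenisation.RealisedQuasiStaticCellLaw
open Summit.AnomalousDissipation.AnomalousDissipation.Theorems.SolenoidalFractalHomogenisation.PermissibleCarrier
open Summit.AnomalousDissipation.AnomalousDissipation.Theorems.SolenoidalFractalHomogenisation.LagrangianStep.ThreeMode

variable {k₀ : ℕ}

/-- **The absolute-time window of slot `s` in period `p`.**  For `t ∈ [pP + start s, pP + start s + τ_s)`: `fract(t/P)·P = t − pP ∈ [start s, start s + τ_s]`
and the envelope of slot `s` there is `trapezoid (pP + start s) τ_s ramp t`. [folklore] -/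
theorem slot_window (W₁ : LatticeWord k₀) (s : Fin k₀) (p : ℤ) {t : ℝ}
    (ht : t ∈ Ico (p * W₁.period + W₁.start s) (p * W₁.period + W₁.start s + (W₁.phase s).τ)) :
    Int.fract (t / W₁.period) * W₁.period = t - p * W₁.period ∧
      Int.fract (t / W₁.period) * W₁.period ∈ Icc (W₁.start s) (W₁.start s + (W₁.phase s).τ) ∧
      LatticeWord.trapezoid (W₁.start s) (W₁.phase s).τ W₁.ramp (Int.fract (t / W₁.period) * W₁.period) =
        LatticeWord.trapezoid (p * W₁.period + W₁.start s) (W₁.phase s).τ W₁.ramp t := by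
  have hP := period_pos W₁
  have hs0 := start_nonneg W₁ s
  have hsP := start_add_tau_le_period W₁ s
  set r : ℝ := t - p * W₁.period with hr
  have ht' : t = p * W₁.period + r := by rw [hr]; ring
  have hr0 : 0 ≤ r := by rw [hr]; linarith [ht.1]
  have hrP : r < W₁.period := by rw [hr]; linarith [ht.2]
  have hphase : Int.fract (t / W₁.period) * W₁.period = r := by rw [ht']; exact fract_period_mul hP p hr0 hrP
  rw [hphase]
  refine ⟨rfl, ⟨by rw [hr]; linarith [ht.1], by rw [hr]; linarith [ht.2]⟩, ?_⟩
  rw [hr]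
  unfold LatticeWord.trapezoid
  ring_nf

/-- The sign choice `σ = sgn(θ)` (with `sgn 0 = 1`): `σ = ±1` and `σ·θ = |θ|`. [folklore] -/
theorem sgn_choice (θ : ℝ) : ((if 0 ≤ θ then (1:ℝ) else -1) = 1 ∨ (if 0 ≤ θ then (1:ℝ) else -1) = -1) ∧
    (if 0 ≤ θ then (1:ℝ) else -1) * θ = |θ| := by
  by_cases h : 0 ≤ θ
  · rw [if_pos h, abs_of_nonneg h, one_mul]; exact ⟨Or.inl rfl, rfl⟩
  · rw [if_neg h, abs_of_neg (not_le.1 h)]; exact ⟨Or.inr rfl, by ring⟩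

/-- **Mode `0` on the window of slot `s`, period `p`**: `HasDerivAt w̃₀ (dW0C (c_s·A_s^p t) K₀ w̃₁ w̃₋₁ ỹ₀) t` for a.e. `t` in the window, all `p` at once,
`c_s = σ(ê_s·K₀)(1/n)/(2|m_s|)`, `A_s^p t = trapezoid (pP + start s) τ_s ramp t`. [cite: BedrossianCotiZelati2017, §2 (hypocoercivity functional with a cross term)] -/
theorem ae_hasDerivAt_window_dW0C (W₁ : LatticeWord k₀) (n : ℕ) {T : ℝ} (hT : 0 ≤ T) {𝔹 : Torus.Visc4 (Fin 3)}
    {F : UnitAddTorus (Fin 3) → EuclideanSpace ℝ (Fin 3)} {u : ℝ → UnitAddTorus (Fin 3) → EuclideanSpace ℝ (Fin 3)}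
    (h : Torus.IsWeakTensorPassiveVectorOn 0 T 𝔹 (W₁.cell n) F u) (hF : Integrable F volume) (s : Fin k₀) (K0 : Fin 3 → ℤ)
    {σ : ℝ} (hσ : σ = 1 ∨ σ = -1) :
    ∀ᵐ t ∂(volume.restrict (Ioo 0 T)), ∀ p : ℤ,
      t ∈ Ico (p * W₁.period + W₁.start s) (p * W₁.period + W₁.start s + (W₁.phase s).τ) →
      HasDerivAt (fun x => ((σ : ℂ) * starRingEnd ℂ (Complex.exp ((W₁.phase s).φ * Complex.I))) ^ (0:ℤ) • modeRep W₁ n 𝔹 F u (K0 + (0:ℤ) • (fun i => (W₁.phase s).m i * (n : ℤ))) x)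
        (dW0C ((σ * (∑ a, (W₁.phase s).e a * (K0 a : ℝ)) * (1 / (n : ℝ)) / (2 * ‖latticeVec (W₁.phase s).m‖)) * LatticeWord.trapezoid (p * W₁.period + W₁.start s) (W₁.phase s).τ W₁.ramp t) (K0 + (0:ℤ) • (fun i => (W₁.phase s).m i * (n : ℤ)))
          (((σ : ℂ) * starRingEnd ℂ (Complex.exp ((W₁.phase s).φ * Complex.I))) ^ (1:ℤ) • modeRep W₁ n 𝔹 F u (K0 + (1:ℤ) • (fun i => (W₁.phase s).m i * (n : ℤ))) t)
          (((σ : ℂ) * starRingEnd ℂ (Complex.exp ((W₁.phase s).φ * Complex.I))) ^ (-1:ℤ) • modeRep W₁ n 𝔹 F u (K0 + (-1:ℤ) • (fun i => (W₁.phase s).m i * (n : ℤ))) t)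
          (Torus.modalAdjGen (Torus.majorTranspose 𝔹) (K0 + (0:ℤ) • (fun i => (W₁.phase s).m i * (n : ℤ))) (((σ : ℂ) * starRingEnd ℂ (Complex.exp ((W₁.phase s).φ * Complex.I))) ^ (0:ℤ) • modeRep W₁ n 𝔹 F u (K0 + (0:ℤ) • (fun i => (W₁.phase s).m i * (n : ℤ))) t))) t := by
  filter_upwards [ae_hasDerivAt_gauged_dW0C W₁ n hT h hF s K0 hσ] with t ht p hp
  obtain ⟨_, hslot, htrap⟩ := slot_window W₁ s p hp
  have h0 := ht hslot
  rw [htrap] at h0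
  rw [show σ * ((∑ a, (W₁.phase s).e a * (K0 a : ℝ)) * ((1 / (n : ℝ)) * LatticeWord.trapezoid (p * W₁.period + W₁.start s) (W₁.phase s).τ W₁.ramp t) / (2 * ‖latticeVec (W₁.phase s).m‖)) = (σ * (∑ a, (W₁.phase s).e a * (K0 a : ℝ)) * (1 / (n : ℝ)) / (2 * ‖latticeVec (W₁.phase s).m‖)) * LatticeWord.trapezoid (p * W₁.period + W₁.start s) (W₁.phase s).τ W₁.ramp t by ring] at h0
  exact h0

/-- **Mode `+1` on the window**: `HasDerivAt w̃₁ (dWpC (c_s·A_s^p t) K₁ w̃₀ w̃₂ ỹ₁) t`. [cite: BedrossianCotiZelati2017, §2 (hypocoercivity functional with a cross term)] -/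
theorem ae_hasDerivAt_window_dWpC (W₁ : LatticeWord k₀) (n : ℕ) {T : ℝ} (hT : 0 ≤ T) {𝔹 : Torus.Visc4 (Fin 3)}
    {F : UnitAddTorus (Fin 3) → EuclideanSpace ℝ (Fin 3)} {u : ℝ → UnitAddTorus (Fin 3) → EuclideanSpace ℝ (Fin 3)}
    (h : Torus.IsWeakTensorPassiveVectorOn 0 T 𝔹 (W₁.cell n) F u) (hF : Integrable F volume) (s : Fin k₀) (K0 : Fin 3 → ℤ)
    {σ : ℝ} (hσ : σ = 1 ∨ σ = -1) :
    ∀ᵐ t ∂(volume.restrict (Ioo 0 T)), ∀ p : ℤ,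
      t ∈ Ico (p * W₁.period + W₁.start s) (p * W₁.period + W₁.start s + (W₁.phase s).τ) →
      HasDerivAt (fun x => ((σ : ℂ) * starRingEnd ℂ (Complex.exp ((W₁.phase s).φ * Complex.I))) ^ (1:ℤ) • modeRep W₁ n 𝔹 F u (K0 + (1:ℤ) • (fun i => (W₁.phase s).m i * (n : ℤ))) x)
        (dWpC ((σ * (∑ a, (W₁.phase s).e a * (K0 a : ℝ)) * (1 / (n : ℝ)) / (2 * ‖latticeVec (W₁.phase s).m‖)) * LatticeWord.trapezoid (p * W₁.period + W₁.start s) (W₁.phase s).τ W₁.ramp t) (K0 + (1:ℤ) • (fun i => (W₁.phase s).m i * (n : ℤ)))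
          (((σ : ℂ) * starRingEnd ℂ (Complex.exp ((W₁.phase s).φ * Complex.I))) ^ (0:ℤ) • modeRep W₁ n 𝔹 F u (K0 + (0:ℤ) • (fun i => (W₁.phase s).m i * (n : ℤ))) t)
          (((σ : ℂ) * starRingEnd ℂ (Complex.exp ((W₁.phase s).φ * Complex.I))) ^ (2:ℤ) • modeRep W₁ n 𝔹 F u (K0 + (2:ℤ) • (fun i => (W₁.phase s).m i * (n : ℤ))) t)
          (Torus.modalAdjGen (Torus.majorTranspose 𝔹) (K0 + (1:ℤ) • (fun i => (W₁.phase s).m i * (n : ℤ))) (((σ : ℂ) * starRingEnd ℂ (Complex.exp ((W₁.phase s).φ * Complex.I))) ^ (1:ℤ) • modeRep W₁ n 𝔹 F u (K0 + (1:ℤ) • (fun i => (W₁.phase s).m i * (n : ℤ))) t))) t := by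
  filter_upwards [ae_hasDerivAt_gauged_dWpC W₁ n hT h hF s K0 hσ] with t ht p hp
  obtain ⟨_, hslot, htrap⟩ := slot_window W₁ s p hp
  have h0 := ht hslot
  rw [htrap] at h0
  rw [show σ * ((∑ a, (W₁.phase s).e a * (K0 a : ℝ)) * ((1 / (n : ℝ)) * LatticeWord.trapezoid (p * W₁.period + W₁.start s) (W₁.phase s).τ W₁.ramp t) / (2 * ‖latticeVec (W₁.phase s).m‖)) = (σ * (∑ a, (W₁.phase s).e a * (K0 a : ℝ)) * (1 / (n : ℝ)) / (2 * ‖latticeVec (W₁.phase s).m‖)) * LatticeWord.trapezoid (p * W₁.period + W₁.start s) (W₁.phase s).τ W₁.ramp t by ring] at h0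
  exact h0

/-- **Mode `−1` on the window**: `HasDerivAt w̃₋₁ (dWmC (c_s·A_s^p t) K₋₁ w̃₀ w̃₋₂ ỹ₋₁) t`. [cite: BedrossianCotiZelati2017, §2 (hypocoercivity functional with a cross term)] -/
theorem ae_hasDerivAt_window_dWmC (W₁ : LatticeWord k₀) (n : ℕ) {T : ℝ} (hT : 0 ≤ T) {𝔹 : Torus.Visc4 (Fin 3)}
    {F : UnitAddTorus (Fin 3) → EuclideanSpace ℝ (Fin 3)} {u : ℝ → UnitAddTorus (Fin 3) → EuclideanSpace ℝ (Fin 3)}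
    (h : Torus.IsWeakTensorPassiveVectorOn 0 T 𝔹 (W₁.cell n) F u) (hF : Integrable F volume) (s : Fin k₀) (K0 : Fin 3 → ℤ)
    {σ : ℝ} (hσ : σ = 1 ∨ σ = -1) :
    ∀ᵐ t ∂(volume.restrict (Ioo 0 T)), ∀ p : ℤ,
      t ∈ Ico (p * W₁.period + W₁.start s) (p * W₁.period + W₁.start s + (W₁.phase s).τ) →
      HasDerivAt (fun x => ((σ : ℂ) * starRingEnd ℂ (Complex.exp ((W₁.phase s).φ * Complex.I))) ^ (-1:ℤ) • modeRep W₁ n 𝔹 F u (K0 + (-1:ℤ) • (fun i => (W₁.phase s).m i * (n : ℤ))) x)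
        (dWmC ((σ * (∑ a, (W₁.phase s).e a * (K0 a : ℝ)) * (1 / (n : ℝ)) / (2 * ‖latticeVec (W₁.phase s).m‖)) * LatticeWord.trapezoid (p * W₁.period + W₁.start s) (W₁.phase s).τ W₁.ramp t) (K0 + (-1:ℤ) • (fun i => (W₁.phase s).m i * (n : ℤ)))
          (((σ : ℂ) * starRingEnd ℂ (Complex.exp ((W₁.phase s).φ * Complex.I))) ^ (0:ℤ) • modeRep W₁ n 𝔹 F u (K0 + (0:ℤ) • (fun i => (W₁.phase s).m i * (n : ℤ))) t)
          (((σ : ℂ) * starRingEnd ℂ (Complex.exp ((W₁.phase s).φ * Complex.I))) ^ (-2:ℤ) • modeRep W₁ n 𝔹 F u (K0 + (-2:ℤ) • (fun i => (W₁.phase s).m i * (n : ℤ))) t)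
          (Torus.modalAdjGen (Torus.majorTranspose 𝔹) (K0 + (-1:ℤ) • (fun i => (W₁.phase s).m i * (n : ℤ))) (((σ : ℂ) * starRingEnd ℂ (Complex.exp ((W₁.phase s).φ * Complex.I))) ^ (-1:ℤ) • modeRep W₁ n 𝔹 F u (K0 + (-1:ℤ) • (fun i => (W₁.phase s).m i * (n : ℤ))) t))) t := by
  filter_upwards [ae_hasDerivAt_gauged_dWmC W₁ n hT h hF s K0 hσ] with t ht p hp
  obtain ⟨_, hslot, htrap⟩ := slot_window W₁ s p hp
  have h0 := ht hslot
  rw [htrap] at h0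
  rw [show σ * ((∑ a, (W₁.phase s).e a * (K0 a : ℝ)) * ((1 / (n : ℝ)) * LatticeWord.trapezoid (p * W₁.period + W₁.start s) (W₁.phase s).τ W₁.ramp t) / (2 * ‖latticeVec (W₁.phase s).m‖)) = (σ * (∑ a, (W₁.phase s).e a * (K0 a : ℝ)) * (1 / (n : ℝ)) / (2 * ‖latticeVec (W₁.phase s).m‖)) * LatticeWord.trapezoid (p * W₁.period + W₁.start s) (W₁.phase s).τ W₁.ramp t by ring] at h0
  exact h0

/-- **The general gauged chain on the window** (every `j : ℤ`): derivative `−modalAdjGen (majorTranspose 𝔹) Kⱼ w̃ⱼ + (c_s·A_s^p t) • P_{Kⱼ}(w̃ⱼ₊₁ − w̃ⱼ₋₁)`.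
[cite: MeshalkinSinai1961, pp. 1700–1705] -/
theorem ae_hasDerivAt_window_chain (W₁ : LatticeWord k₀) (n : ℕ) {T : ℝ} (hT : 0 ≤ T) {𝔹 : Torus.Visc4 (Fin 3)}
    {F : UnitAddTorus (Fin 3) → EuclideanSpace ℝ (Fin 3)} {u : ℝ → UnitAddTorus (Fin 3) → EuclideanSpace ℝ (Fin 3)}
    (h : Torus.IsWeakTensorPassiveVectorOn 0 T 𝔹 (W₁.cell n) F u) (hF : Integrable F volume) (s : Fin k₀) (K0 : Fin 3 → ℤ)
    {σ : ℝ} (hσ : σ = 1 ∨ σ = -1) :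
    ∀ᵐ t ∂(volume.restrict (Ioo 0 T)), ∀ p : ℤ,
      t ∈ Ico (p * W₁.period + W₁.start s) (p * W₁.period + W₁.start s + (W₁.phase s).τ) →
      ∀ j : ℤ, HasDerivAt (fun x => ((σ : ℂ) * starRingEnd ℂ (Complex.exp ((W₁.phase s).φ * Complex.I))) ^ j • modeRep W₁ n 𝔹 F u (K0 + j • (fun i => (W₁.phase s).m i * (n : ℤ))) x)
        (-(Torus.modalAdjGen (Torus.majorTranspose 𝔹) (K0 + j • (fun i => (W₁.phase s).m i * (n : ℤ))) (((σ : ℂ) * starRingEnd ℂ (Complex.exp ((W₁.phase s).φ * Complex.I))) ^ j • modeRep W₁ n 𝔹 F u (K0 + j • (fun i => (W₁.phase s).m i * (n : ℤ))) t)) +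
          (((σ * (∑ a, (W₁.phase s).e a * (K0 a : ℝ)) * (1 / (n : ℝ)) / (2 * ‖latticeVec (W₁.phase s).m‖)) * LatticeWord.trapezoid (p * W₁.period + W₁.start s) (W₁.phase s).τ W₁.ramp t : ℝ) : ℂ) • transversalProj (K0 + j • (fun i => (W₁.phase s).m i * (n : ℤ)))
            (((σ : ℂ) * starRingEnd ℂ (Complex.exp ((W₁.phase s).φ * Complex.I))) ^ (j + 1) • modeRep W₁ n 𝔹 F u (K0 + (j + 1) • (fun i => (W₁.phase s).m i * (n : ℤ))) t -
              ((σ : ℂ) * starRingEnd ℂ (Complex.exp ((W₁.phase s).φ * Complex.I))) ^ (j - 1) • modeRep W₁ n 𝔹 F u (K0 + (j - 1) • (fun i => (W₁.phase s).m i * (n : ℤ))) t)) t := by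
  filter_upwards [ae_hasDerivAt_gauged_chain W₁ n hT h hF s K0 hσ] with t ht p hp j
  obtain ⟨_, hslot, htrap⟩ := slot_window W₁ s p hp
  have h0 := ht hslot j
  rw [htrap] at h0
  rw [show σ * ((∑ a, (W₁.phase s).e a * (K0 a : ℝ)) * ((1 / (n : ℝ)) * LatticeWord.trapezoid (p * W₁.period + W₁.start s) (W₁.phase s).τ W₁.ramp t) / (2 * ‖latticeVec (W₁.phase s).m‖)) = (σ * (∑ a, (W₁.phase s).e a * (K0 a : ℝ)) * (1 / (n : ℝ)) / (2 * ‖latticeVec (W₁.phase s).m‖)) * LatticeWord.trapezoid (p * W₁.period + W₁.start s) (W₁.phase s).τ W₁.ramp t by ring] at h0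
  exact h0

end Summit.AnomalousDissipation.AnomalousDissipation.Theorems.SolenoidalFractalHomogenisation.LagrangianStep.CellChain

end
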